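import Summits.HodgeConjecture.HodgeConjecture.Theorems.MarkmanPartnerTransportK3Sq2OneCycleFifthRM
import Summits.HodgeConjecture.HodgeConjecture.Theorems.MarkmanPartnerTransportLowPicardRMCellOneTwoKugaSatake

/-!
# Route MarkmanPartnerTransport · crux #5 `LowPicardRealMultiplication` — «ODD-CELL X-SOCKETS»: in five of the
# six cells ONE real-multiplication cycle per member gives HC⁴ on the cell, by name

Planner p1 g39, TARGET «ODD-CELL X-SOCKETS» (2026-08-28T16:36Z); prover seat hodge-nonav-20241-p1 (gen 15). The
`X`-side twin of the K3-side sockets `…PicardThreeK3SquaresHeckeSpread` (p648100): the POINTWISE one-cycle theorem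
extracted from `lowPicardRealMultiplication_of_oneCycleFifth` (`…K3Sq2OneCycleFifth`, where only the `∀`-form is
stated), the DEGREE LAWS of the cells of «CELL-SPLIT» (`…LowPicardRMCells`), and the per-cell closers — so that with
`lowPicardRealMultiplication_iff_six_cells` (`…LowPicardRMSectors` :209) crux #5's open cells read «ONE RM cycle per
member» BY NAME. This is the only road into the orphan cell `(1,2)` (no K3 surface there).

* DEGREE LAWS `degree_law_cell12 ∕ 23 ∕ 27 ∕ 34 ∕ 35` — for `(ρ, d) ∈ {(1,2), (2,3), (2,7), (3,4), (3,5)}`: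
  `∀ j ≥ 2, m ≥ 3, d·j·m + ρ ≠ 23` (`2jm = 22 ⇒ jm = 11`; `3jm = 21 ⇒ jm = 7`; `7jm = 21 ⇒ jm = 3`; `4jm = 20 ⇒ jm = 5`;
  `5jm = 20 ⇒ jm = 4` — all impossible with `j ≥ 2`, `m ≥ 3`), i.e. the arithmetic clause of `OneRMCycle[X, φ, z, hX]`
  (`…K3Sq2OneCycleFifthRM` :60) holds with `k := d`; and `not_degree_law_cell32` — the sixth cell `(3,2)` FAILS it
  (`2·2·5 + 3 = 23`: a quadratic eigenvalue does not exclude a quartic `E` by arithmetic alone; that cell has the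
  Kuga–Satake road, `…LowPicardRMCellOneTwoKugaSatake`).
* POINTWISE SOCKET `hodgeConjectureFor_of_oneRMCycle_of_not_spannedByIsometries` — a marked smooth projective
  `K3^{[2]}`-type `X` with `¬ SpannedByIsometries` carrying `OneRMCycle[X, φ, z, hX]` (ONE algebraic `Z ∈ A⁴(X × X)`
  acting rationally and type-preservingly with `σ`-eigenvalue of minpoly degree `k`, `k·j·m + ρ(X) ≠ 23`) satisfies
  `HodgeConjectureFor 4 X`, modulo EXACTLY {`VerbitskyGuan_cohomology_K3HilbertSquareType`,
  `OGrady2008_dualBBFClass_algebraic`, `QInvAlgebraic`} (the facts of `lowPicardRealMultiplication_of_oneCycleFifth`);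
  `…_of_charlesMarkman` modulo {Verbitsky–Guan, O'Grady, `CharlesMarkman2013_lefschetzStandard_K3HilbertType`}.
  Proof = the body of the `∀`-form: `generatedBy_or_cm_of_eigenvalue_natDegree`, the CM alternative killed by
  `spannedByIsometries_of_cm` against `¬ SpIso`, then the `X`-side F4 `hodgeConjectureFor_of_cycleInducedGenerator`.
  `hodgeConjectureFor_of_oneCellCycle_of_rmGenerator` — the same inside a cell: `RMgen[X, φ, z, d]`, the degree law
  for `(ρ(X), d)`, and ONE cycle whose `σ`-eigenvalue has minpoly degree `d` (`OneCellCycle[X, φ, z, hX, d]`).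
* CELL CLOSERS `cellHC_of_forall_oneRMCycle` (any cell: `OneRMCycle` on every member ⟹ `CellHC[ρ, d]`),
  `cellHC_of_forall_oneCellCycle` (given the degree law: a degree-`d` cycle on every member ⟹ `CellHC[ρ, d]`) and the
  five instances `cellHC_of_forall_oneCellCycle_12 ∕ 23 ∕ 27 ∕ 34 ∕ 35`; and crux #5 BY NAME:
  `lowPicardRealMultiplication_of_forall_oneCellCycle_of_cellHC32` (five one-cycle clauses + `CellHC[3, 2]`) and
  `lowPicardRealMultiplication_of_kugaSatake_of_forall_oneCellCycle` (Kuga–Satake on the quadratic cells + one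
  degree-`d` cycle per member on `(2,3)`, `(2,7)`, `(3,4)`, `(3,5)`).

CONDITIONAL on the displayed named facts; no definition, no sorry. Imports `…K3Sq2OneCycleFifthRM` and
`…LowPicardRMCellOneTwoKugaSatake` (hence `…LowPicardRMCells`; all already in the route cone); notations copied verbatim. `--supports stmt-HodgeConjecture-19653`.
Nothing here proves the crux or HC; the one RM cycle per member is the open geometric content (chapter P1AL:
Hecke sources H-T1 ∕ H-T2 on the K3 side, NS-absorption seeds on the `X` side).

References: E. Markman, Compos. Math. 160 (2024) Thm. 1.1; M. Varesco, Math. Z. 305 (2023) §2; B. van Geemen,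
Michigan Math. J. 56 (2008) Lemma 3.2; Yu. Zarhin, J. reine angew. Math. 341 (1983) Thm. 1.5.1, 1.6.
-/

noncomputable section

set_option linter.dupNamespace false

open Module CategoryTheory MonoidalCategory Polynomial
open Literature.AlgebraicTopology.SingularHomology Literature.Geometry.Kaehler
open Literature.AlgebraicGeometry Literature.AlgebraicGeometry.Motives Literature.AlgebraicGeometry.HodgeTheory
open Literature.AlgebraicGeometry.Hyperkaehler Literature.AlgebraicGeometry.Surfaces
open Summit.HodgeConjecture.HodgeConjecture.Theorems.NikulinTwinTransport

namespace Summit.HodgeConjecture.HodgeConjecture.Theorems.MarkmanPartnerTransport.PartnerLattice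

/-- `MarkedK3Sq[X, φ, P, z]`: VERBATIM the `let MarkedK3Sq := …` binder of the route declarations of
MarkmanPartnerTransport (clauses (m1)–(m6)). Local notation only. -/
local notation3 (prettyPrint := false) "MarkedK3Sq[" X ", " φ ", " P ", " z "]" =>
  (((IsIntegralClass P ∧ ∀ Q : complexBetti X (2 * 4), IsIntegralClass Q → ∃ n : ℤ, Q = n • P) ∧
    (∀ c : complexBetti X 2, IsIntegralClass c ↔ ∃ v : K3HilbertIndex → ℤ, φ c = fun i => (v i : ℂ)) ∧
    (∀ a : complexBetti X 2, cupPowTwo a 4 = ((3 : ℂ) * (k3HilbertForm 2 (φ a) (φ a)) ^ 2) • P) ∧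
    (IsOfHodgeType 4 X 2 2 0 (LinearEquiv.symm φ z) ∧
      ∀ τ : complexBetti X 2, IsOfHodgeType 4 X 2 2 0 τ → ∃ t : ℂ, τ = t • LinearEquiv.symm φ z) ∧
    (∀ c : complexBetti X 2, IsOfHodgeType 4 X 2 1 1 c ↔
      (k3HilbertForm 2 (φ c) z = 0 ∧ k3HilbertForm 2 (φ c) (star z) = 0)) ∧
    (k3HilbertForm 2 z z = 0 ∧ 0 < (k3HilbertForm 2 (star z) z).re)))

/-- `SpIso[X, φ]`: VERBATIM the `let SpannedByIsometries := …` binder of the route declarations (with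
`IsBBFTransc` unfolded). Local notation only. -/
local notation3 (prettyPrint := false) "SpIso[" X ", " φ "]" =>
  (∀ f : complexBetti X 2 →ₗ[ℂ] complexBetti X 2, (∀ y, IsRationalClass y → IsRationalClass (f y)) →
    (∀ (i j : ℕ) y, IsOfHodgeType 4 X 2 i j y → IsOfHodgeType 4 X 2 i j (f y)) →
    (∀ d : complexBetti X 2, d ∈ algebraicClasses X 1 → f d = 0) →
    (∀ y : complexBetti X 2, ∀ d : complexBetti X 2, d ∈ algebraicClasses X 1 →
      k3HilbertForm 2 (φ (f y)) (φ d) = 0) →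
    ∃ (k : ℕ) (c : Fin k → ℚ) (g : Fin k → (complexBetti X 2 →ₗ[ℂ] complexBetti X 2)),
      (∀ i, Function.Bijective (g i) ∧ (∀ y, IsRationalClass y → IsRationalClass (g i y)) ∧
        (∀ (a b : ℕ) y, IsOfHodgeType 4 X 2 a b y → IsOfHodgeType 4 X 2 a b (g i y)) ∧
        (∀ a b, k3HilbertForm 2 (φ (g i a)) (φ (g i b)) = k3HilbertForm 2 (φ a) (φ b))) ∧
      ∀ y : complexBetti X 2, (∀ d : complexBetti X 2, d ∈ algebraicClasses X 1 →
        k3HilbertForm 2 (φ y) (φ d) = 0) → f y = ∑ i : Fin k, ((c i : ℂ) • g i y))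

/-- `RMgen[X, φ, z, d]` (VERBATIM `…LowPicardRMCells`): a rational, type-preserving, `q`-self-adjoint endomorphism
`θ` of `H²(X(ℂ); ℂ)` with `θ σ = ev · σ`, `ev` real, `deg minpoly_ℚ(ev) = d`, `d · n + ρ(X) = 23` for some `n ≥ 3`, and
GEN: every rational type-preserving endomorphism is `Σ_{i<d} cᵢ θⁱ` (`cᵢ ∈ ℚ`) on `T(X)_ℂ`. Local notation only. -/
local notation3 (prettyPrint := false) "RMgen[" X ", " φ ", " z ", " d "]" =>
  (∃ θ : complexBetti X 2 →ₗ[ℂ] complexBetti X 2, (∀ y, IsRationalClass y → IsRationalClass (θ y)) ∧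
    (∀ (i j : ℕ) y, IsOfHodgeType 4 X 2 i j y → IsOfHodgeType 4 X 2 i j (θ y)) ∧
    (∀ y w : complexBetti X 2, k3HilbertForm 2 (φ (θ y)) (φ w) = k3HilbertForm 2 (φ y) (φ (θ w))) ∧
    ∃ ev : ℂ, θ (LinearEquiv.symm φ z) = ev • LinearEquiv.symm φ z ∧ ev.im = 0 ∧
      (minpoly ℚ ev).natDegree = d ∧
      (∃ n : ℕ, 3 ≤ n ∧ d * n + Module.finrank ℂ ↥(algebraicClasses X 1) = 23) ∧
      ∀ f : complexBetti X 2 →ₗ[ℂ] complexBetti X 2, (∀ y, IsRationalClass y → IsRationalClass (f y)) →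
        (∀ (i j : ℕ) y, IsOfHodgeType 4 X 2 i j y → IsOfHodgeType 4 X 2 i j (f y)) →
        ∃ c : Fin d → ℚ, ∀ y : complexBetti X 2,
          (∀ a : complexBetti X 2, a ∈ algebraicClasses X 1 → k3HilbertForm 2 (φ y) (φ a) = 0) →
            f y = ∑ i : Fin d, ((c i : ℂ) • (θ ^ (i : ℕ)) y))

/-- `CellHC[ρ, d]` (VERBATIM `…LowPicardRMCells`): **HC⁴ on the cell `(ρ(X), [E:ℚ]) = (ρ, d)`**. Local notation only. -/
local notation3 (prettyPrint := false) "CellHC[" ρ ", " d "]" =>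
  (∀ (X : SchemeOver ℂ), IsSmoothProjective 4 X → IsOfK3HilbertSquareType X →
    ∀ (φ : complexBetti X 2 ≃ₗ[ℂ] (K3HilbertIndex → ℂ)) (P : complexBetti X (2 * 4)) (z : K3HilbertIndex → ℂ),
      MarkedK3Sq[X, φ, P, z] → ¬ SpIso[X, φ] → Module.finrank ℂ ↥(algebraicClasses X 1) = ρ →
        RMgen[X, φ, z, d] → HodgeConjectureFor 4 X)

/-- `OneRMCycle[X, φ, z, hX]` (VERBATIM `…K3Sq2OneCycleFifthRM` :60): the positive one-cycle clause (degree form) —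
ONE algebraic class `Z ∈ A⁴(X × X)` whose action on `H²(X)` is rational, type-preserving, with eigenvalue `ev` on `σ`,
`deg minpoly_ℚ(ev) = k`, `k · j · m + ρ(X) ≠ 23`. Local notation only. -/
local notation3 (prettyPrint := false) "OneRMCycle[" X ", " φ ", " z ", " hX "]" =>
  (∃ (k : ℕ) (t : complexBetti X 2 →ₗ[ℂ] complexBetti X 2),
    (∀ j m : ℕ, 2 ≤ j → 3 ≤ m → k * j * m + Module.finrank ℂ ↥(algebraicClasses X 1) ≠ 23) ∧
    (∀ y, IsRationalClass y → IsRationalClass (t y)) ∧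
    (∀ (a b : ℕ) y, IsOfHodgeType 4 X 2 a b y → IsOfHodgeType 4 X 2 a b (t y)) ∧
    (∃ Z ∈ algebraicClasses (X ⊗ X) 4, ∀ y : complexBetti X 2,
      t y = corrAction complexOrientationFamily hX hX (rfl : 2 + 2 * 4 = 2 + 2 * 4) Z y) ∧
    ∃ ev : ℂ, t (LinearEquiv.symm φ z) = ev • LinearEquiv.symm φ z ∧ (minpoly ℚ ev).natDegree = k)

/-- `OneCellCycle[X, φ, z, hX, d]`: the one-cycle datum WITHIN A CELL of degree `d` — ONE algebraic class
`Z ∈ A⁴(X × X)` whose action on `H²(X)` is rational, type-preserving, with eigenvalue `ev` on `σ = φ⁻¹ z` of minpoly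
degree EXACTLY `d` (the degree `[E:ℚ]` of the cell: the cycle's eigenvalue generates the RM field). `OneRMCycle`
without its arithmetic clause, which the cell supplies (`degree_law_cell…`). Local notation only. -/
local notation3 (prettyPrint := false) "OneCellCycle[" X ", " φ ", " z ", " hX ", " d "]" =>
  (∃ t : complexBetti X 2 →ₗ[ℂ] complexBetti X 2,
    (∀ y, IsRationalClass y → IsRationalClass (t y)) ∧
    (∀ (a b : ℕ) y, IsOfHodgeType 4 X 2 a b y → IsOfHodgeType 4 X 2 a b (t y)) ∧
    (∃ Z ∈ algebraicClasses (X ⊗ X) 4, ∀ y : complexBetti X 2,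
      t y = corrAction complexOrientationFamily hX hX (rfl : 2 + 2 * 4 = 2 + 2 * 4) Z y) ∧
    ∃ ev : ℂ, t (LinearEquiv.symm φ z) = ev • LinearEquiv.symm φ z ∧ (minpoly ℚ ev).natDegree = d)

/-- `OneCycleOnCell[ρ, d]`: «every member of the cell `(ρ, d)` carries one degree-`d` RM cycle». Local notation only. -/
local notation3 (prettyPrint := false) "OneCycleOnCell[" ρ ", " d "]" =>
  (∀ (X : SchemeOver ℂ) (hX : IsSmoothProjective 4 X), IsOfK3HilbertSquareType X →
    ∀ (φ : complexBetti X 2 ≃ₗ[ℂ] (K3HilbertIndex → ℂ)) (P : complexBetti X (2 * 4)) (z : K3HilbertIndex → ℂ),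
      MarkedK3Sq[X, φ, P, z] → ¬ SpIso[X, φ] → Module.finrank ℂ ↥(algebraicClasses X 1) = ρ →
        RMgen[X, φ, z, d] → OneCellCycle[X, φ, z, hX, d])

/-- `KSHC[hX]` (VERBATIM `…LowPicardRMCellOneTwoKugaSatake`): the Kuga–Satake Hodge conjecture for the
`K3^{[2]}`-type fourfold `X`. Local notation only. -/
local notation3 (prettyPrint := false) "KSHC[" hX "]" => (IsKSCorrespondenceAlgebraicHK 2 hX)

variable {X : SchemeOver ℂ} {φ : complexBetti X 2 ≃ₗ[ℂ] (K3HilbertIndex → ℂ)} {P : complexBetti X (2 * 4)}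
  {z : K3HilbertIndex → ℂ}

/-! ### (i) The degree laws of the cells -/

/-- **Degree law of the orphan cell `(1,2)`**: `2·j·m + 1 ≠ 23` for `j ≥ 2`, `m ≥ 3` (`jm = 11` is prime). [folklore] -/
theorem degree_law_cell12 : ∀ j m : ℕ, 2 ≤ j → 3 ≤ m → 2 * j * m + 1 ≠ 23 := by
  intro j m hj hm h
  have hjm : j * m = 11 := by nlinarith
  rcases (Nat.dvd_prime (by norm_num : Nat.Prime 11)).1 ⟨m, hjm.symm⟩ with h1 | h11
  · omega
  · subst h11; omega

/-- **Degree law of cell `(2,3)`**: `3·j·m + 2 ≠ 23` for `j ≥ 2`, `m ≥ 3` (`jm = 7` is prime). [folklore] -/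
theorem degree_law_cell23 : ∀ j m : ℕ, 2 ≤ j → 3 ≤ m → 3 * j * m + 2 ≠ 23 := by
  intro j m hj hm h
  have hjm : j * m = 7 := by nlinarith
  rcases (Nat.dvd_prime (by norm_num : Nat.Prime 7)).1 ⟨m, hjm.symm⟩ with h1 | h7
  · omega
  · subst h7; omega

/-- **Degree law of cell `(2,7)`**: `7·j·m + 2 ≠ 23` for `j ≥ 2`, `m ≥ 3` (`jm = 3 < 6`). [folklore] -/
theorem degree_law_cell27 : ∀ j m : ℕ, 2 ≤ j → 3 ≤ m → 7 * j * m + 2 ≠ 23 := by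
  intro j m hj hm h
  nlinarith

/-- **Degree law of cell `(3,4)`**: `4·j·m + 3 ≠ 23` for `j ≥ 2`, `m ≥ 3` (`jm = 5` is prime). [folklore] -/
theorem degree_law_cell34 : ∀ j m : ℕ, 2 ≤ j → 3 ≤ m → 4 * j * m + 3 ≠ 23 := by
  intro j m hj hm h
  have hjm : j * m = 5 := by nlinarith
  rcases (Nat.dvd_prime (by norm_num : Nat.Prime 5)).1 ⟨m, hjm.symm⟩ with h1 | h5
  · omega
  · subst h5; omega

/-- **Degree law of cell `(3,5)`**: `5·j·m + 3 ≠ 23` for `j ≥ 2`, `m ≥ 3` (`jm = 4 < 6`) — the even-`ℓ` cell `(3,5)`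
satisfies the law too, so five of the six cells do. [folklore] -/
theorem degree_law_cell35 : ∀ j m : ℕ, 2 ≤ j → 3 ≤ m → 5 * j * m + 3 ≠ 23 := by
  intro j m hj hm h
  nlinarith

/-- **The sixth cell `(3,2)` FAILS the degree law**: `2·2·5 + 3 = 23` — a quadratic `σ`-eigenvalue on a fourfold
with `ρ(X) = 3` does not by arithmetic alone exclude a QUARTIC endomorphism field (`[E:ℚ] = 4`, `dim_E T = 5`);
that cell is served by the Kuga–Satake road (`cellHC_two_of_kugaSatake`). [folklore] -/
theorem not_degree_law_cell32 : ¬ ∀ j m : ℕ, 2 ≤ j → 3 ≤ m → 2 * j * m + 3 ≠ 23 :=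
  fun h => h 2 5 le_rfl (by norm_num) (by norm_num)

/-! ### (ii) The pointwise sockets -/

/-- **POINTWISE ONE-CYCLE SOCKET under `¬ SpannedByIsometries`** (the body of
`lowPicardRealMultiplication_of_oneCycleFifth`, extracted): a marked smooth projective `K3^{[2]}`-type `X` with
`¬ SpIso[X, φ]` carrying `OneRMCycle[X, φ, z, hX]` satisfies `HodgeConjectureFor 4 X` — the engine
`generatedBy_or_cm_of_eigenvalue_natDegree` gives `GenX` or CM; CM forces `SpannedByIsometries`
(`spannedByIsometries_of_cm`), excluded; `GenX` feeds the `X`-side F4 `hodgeConjectureFor_of_cycleInducedGenerator`.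
Modulo {Verbitsky–Guan, O'Grady, `QInvAlgebraic`}. [cite: Markman2024, §1.1 Thm. 1.1] [cite: Varesco2023, §2 (p. 8)]
[cite: Vangeemen2008, Lemma 3.2] [cite: Zarhin1983HodgeGroupsK3, Thm. 1.5.1 and Thm. 1.6] -/
theorem hodgeConjectureFor_of_oneRMCycle_of_not_spannedByIsometries
    (hV : VerbitskyGuan_cohomology_K3HilbertSquareType) (hO : OGrady2008_dualBBFClass_algebraic) (hQ : QInvAlgebraic)
    (hX : IsSmoothProjective 4 X) (hK : IsOfK3HilbertSquareType X) (hM : MarkedK3Sq[X, φ, P, z]) (hsp : ¬ SpIso[X, φ])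
    (h : OneRMCycle[X, φ, z, hX]) : HodgeConjectureFor 4 X := by
  obtain ⟨k, t, hk, ht_rat, ht_typ, ht_cyc, ev, ht_ev, hdeg⟩ := h
  rcases generatedBy_or_cm_of_eigenvalue_natDegree hX hM hk t ht_rat ht_typ ht_ev hdeg with
    hgen | ⟨-, Ψ, hΨrat, hΨ11, μ, hμ, hΨσ⟩
  · exact hodgeConjectureFor_of_cycleInducedGenerator hV hO hQ hX hK hM t ht_rat ht_typ ht_cyc hgen
  · exact absurd (spannedByIsometries_of_cm hX hM Ψ hΨrat hΨ11 hΨσ hμ) hsp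

/-- **POINTWISE ONE-CYCLE SOCKET under `¬ SpannedByIsometries`, from the route's published facts** {Verbitsky–Guan,
O'Grady, Charles–Markman 2013} (`QInvAlgebraic` by `qInvAlgebraic_of_charlesMarkman`). CONDITIONAL; credits nothing.
[cite: CharlesMarkman2013, Thm. 1.1 (§1)] [cite: Markman2024, §1.1 Thm. 1.1] [cite: Varesco2023, §2 (p. 8)] -/
theorem hodgeConjectureFor_of_oneRMCycle_of_not_spannedByIsometries_of_charlesMarkman
    (hV : VerbitskyGuan_cohomology_K3HilbertSquareType) (hO : OGrady2008_dualBBFClass_algebraic)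
    (hB : CharlesMarkman2013_lefschetzStandard_K3HilbertType)
    (hX : IsSmoothProjective 4 X) (hK : IsOfK3HilbertSquareType X) (hM : MarkedK3Sq[X, φ, P, z]) (hsp : ¬ SpIso[X, φ])
    (h : OneRMCycle[X, φ, z, hX]) : HodgeConjectureFor 4 X :=
  hodgeConjectureFor_of_oneRMCycle_of_not_spannedByIsometries hV hO (qInvAlgebraic_of_charlesMarkman hV hB) hX hK hM
    hsp h

/-- **From a degree-`d` cycle in a cell to `OneRMCycle`**: if `(ρ(X), d)` satisfies the degree law, a cycle whose
`σ`-eigenvalue has minpoly degree `d` is an `OneRMCycle` datum with `k := d`. [folklore] -/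
theorem oneRMCycle_of_oneCellCycle (hX : IsSmoothProjective 4 X) {d : ℕ}
    (hlaw : ∀ j m : ℕ, 2 ≤ j → 3 ≤ m → d * j * m + Module.finrank ℂ ↥(algebraicClasses X 1) ≠ 23)
    (h : OneCellCycle[X, φ, z, hX, d]) : OneRMCycle[X, φ, z, hX] := by
  obtain ⟨t, ht_rat, ht_typ, ht_cyc, ev, ht_ev, hdeg⟩ := h
  exact ⟨d, t, hlaw, ht_rat, ht_typ, ht_cyc, ev, ht_ev, hdeg⟩

/-- **POINTWISE SOCKET INSIDE A CELL**: a marked smooth projective `K3^{[2]}`-type `X` with `¬ SpIso[X, φ]`,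
`ρ(X) = ρ`, the degree law for `(ρ, d)`, and ONE algebraic class acting with `σ`-eigenvalue of minpoly degree `d`
(`OneCellCycle[X, φ, z, hX, d]`) satisfies `HodgeConjectureFor 4 X` — modulo {Verbitsky–Guan, O'Grady, `QInvAlgebraic`}.
(The `RMgen` datum of the cell is not needed by the proof; the degree law replaces it.) [cite: Markman2024, §1.1 Thm. 1.1]
[cite: Vangeemen2008, Lemma 3.2] [cite: Zarhin1983HodgeGroupsK3, Thm. 1.5.1 and Thm. 1.6] -/
theorem hodgeConjectureFor_of_oneCellCycle_of_degreeLaw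
    (hV : VerbitskyGuan_cohomology_K3HilbertSquareType) (hO : OGrady2008_dualBBFClass_algebraic) (hQ : QInvAlgebraic)
    (hX : IsSmoothProjective 4 X) (hK : IsOfK3HilbertSquareType X) (hM : MarkedK3Sq[X, φ, P, z]) (hsp : ¬ SpIso[X, φ])
    {ρ d : ℕ} (hρ : Module.finrank ℂ ↥(algebraicClasses X 1) = ρ)
    (hlaw : ∀ j m : ℕ, 2 ≤ j → 3 ≤ m → d * j * m + ρ ≠ 23) (h : OneCellCycle[X, φ, z, hX, d]) :
    HodgeConjectureFor 4 X :=
  hodgeConjectureFor_of_oneRMCycle_of_not_spannedByIsometries hV hO hQ hX hK hM hsp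
    (oneRMCycle_of_oneCellCycle hX (fun j m hj hm => by rw [hρ]; exact hlaw j m hj hm) h)

/-! ### (iii) The cell closers -/

/-- **`OneRMCycle` on every member of a cell ⟹ HC⁴ on the cell** (any `(ρ, d)`; the arithmetic clause travels with
each cycle). Modulo {Verbitsky–Guan, O'Grady, `QInvAlgebraic`}. [cite: Markman2024, §1.1 Thm. 1.1]
[cite: Vangeemen2008, Lemma 3.2] -/
theorem cellHC_of_forall_oneRMCycle
    (hV : VerbitskyGuan_cohomology_K3HilbertSquareType) (hO : OGrady2008_dualBBFClass_algebraic) (hQ : QInvAlgebraic)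
    {ρ d : ℕ}
    (h : ∀ (X : SchemeOver ℂ) (hX : IsSmoothProjective 4 X), IsOfK3HilbertSquareType X →
      ∀ (φ : complexBetti X 2 ≃ₗ[ℂ] (K3HilbertIndex → ℂ)) (P : complexBetti X (2 * 4)) (z : K3HilbertIndex → ℂ),
        MarkedK3Sq[X, φ, P, z] → ¬ SpIso[X, φ] → Module.finrank ℂ ↥(algebraicClasses X 1) = ρ →
          RMgen[X, φ, z, d] → OneRMCycle[X, φ, z, hX]) :
    CellHC[ρ, d] :=
  fun X hX hK φ P z hM hsp hρ hR =>
    hodgeConjectureFor_of_oneRMCycle_of_not_spannedByIsometries hV hO hQ hX hK hM hsp (h X hX hK φ P z hM hsp hρ hR)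

/-- **A degree-`d` RM cycle on every member of a cell satisfying the degree law ⟹ HC⁴ on the cell.** Modulo
{Verbitsky–Guan, O'Grady, `QInvAlgebraic`}. [cite: Markman2024, §1.1 Thm. 1.1] [cite: Vangeemen2008, Lemma 3.2] -/
theorem cellHC_of_forall_oneCellCycle
    (hV : VerbitskyGuan_cohomology_K3HilbertSquareType) (hO : OGrady2008_dualBBFClass_algebraic) (hQ : QInvAlgebraic)
    {ρ d : ℕ} (hlaw : ∀ j m : ℕ, 2 ≤ j → 3 ≤ m → d * j * m + ρ ≠ 23) (h : OneCycleOnCell[ρ, d]) : CellHC[ρ, d] :=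
  fun X hX hK φ P z hM hsp hρ hR =>
    hodgeConjectureFor_of_oneCellCycle_of_degreeLaw hV hO hQ hX hK hM hsp hρ hlaw (h X hX hK φ P z hM hsp hρ hR)

/-- **Cell `(1,2)` (the orphan cell — no K3 surface has `dim T = 22`): one quadratic RM cycle per member ⟹
`CellHC[1, 2]`.** Modulo {Verbitsky–Guan, O'Grady, `QInvAlgebraic`}. [cite: Markman2024, §1.1 Thm. 1.1] -/
theorem cellHC_of_forall_oneCellCycle_12
    (hV : VerbitskyGuan_cohomology_K3HilbertSquareType) (hO : OGrady2008_dualBBFClass_algebraic) (hQ : QInvAlgebraic)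
    (h : OneCycleOnCell[1, 2]) : CellHC[1, 2] :=
  cellHC_of_forall_oneCellCycle hV hO hQ degree_law_cell12 h

/-- **Cell `(2,3)`: one cubic RM cycle per member ⟹ `CellHC[2, 3]`.** Modulo {Verbitsky–Guan, O'Grady, `QInvAlgebraic`}.
[cite: Markman2024, §1.1 Thm. 1.1] -/
theorem cellHC_of_forall_oneCellCycle_23
    (hV : VerbitskyGuan_cohomology_K3HilbertSquareType) (hO : OGrady2008_dualBBFClass_algebraic) (hQ : QInvAlgebraic)
    (h : OneCycleOnCell[2, 3]) : CellHC[2, 3] :=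
  cellHC_of_forall_oneCellCycle hV hO hQ degree_law_cell23 h

/-- **Cell `(2,7)`: one septic RM cycle per member ⟹ `CellHC[2, 7]`.** Modulo {Verbitsky–Guan, O'Grady, `QInvAlgebraic`}.
[cite: Markman2024, §1.1 Thm. 1.1] -/
theorem cellHC_of_forall_oneCellCycle_27
    (hV : VerbitskyGuan_cohomology_K3HilbertSquareType) (hO : OGrady2008_dualBBFClass_algebraic) (hQ : QInvAlgebraic)
    (h : OneCycleOnCell[2, 7]) : CellHC[2, 7] :=
  cellHC_of_forall_oneCellCycle hV hO hQ degree_law_cell27 h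

/-- **Cell `(3,4)`: one quartic RM cycle per member ⟹ `CellHC[3, 4]`.** Modulo {Verbitsky–Guan, O'Grady, `QInvAlgebraic`}.
[cite: Markman2024, §1.1 Thm. 1.1] -/
theorem cellHC_of_forall_oneCellCycle_34
    (hV : VerbitskyGuan_cohomology_K3HilbertSquareType) (hO : OGrady2008_dualBBFClass_algebraic) (hQ : QInvAlgebraic)
    (h : OneCycleOnCell[3, 4]) : CellHC[3, 4] :=
  cellHC_of_forall_oneCellCycle hV hO hQ degree_law_cell34 h

/-- **Cell `(3,5)`: one quintic RM cycle per member ⟹ `CellHC[3, 5]`.** Modulo {Verbitsky–Guan, O'Grady, `QInvAlgebraic`}.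
[cite: Markman2024, §1.1 Thm. 1.1] -/
theorem cellHC_of_forall_oneCellCycle_35
    (hV : VerbitskyGuan_cohomology_K3HilbertSquareType) (hO : OGrady2008_dualBBFClass_algebraic) (hQ : QInvAlgebraic)
    (h : OneCycleOnCell[3, 5]) : CellHC[3, 5] :=
  cellHC_of_forall_oneCellCycle hV hO hQ degree_law_cell35 h

/-! ### Crux #5 by name from one cycle per member on five cells -/

/-- **Crux #5 `LowPicardRealMultiplication` BY NAME from one degree-`d` RM cycle per member on the five cells
`(1,2), (2,3), (2,7), (3,4), (3,5)` and HC⁴ on the sixth cell `(3,2)`** («CELL-SPLIT»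
`lowPicardRealMultiplication_of_six_cells` + the cell closers above). Modulo {Verbitsky–Guan, O'Grady, `QInvAlgebraic`};
CONDITIONAL on the one-cycle clauses (open geometry); credits nothing to HC. [cite: Markman2024, §1.1 Thm. 1.1]
[cite: Vangeemen2008, Lemma 3.2] [cite: Zarhin1983HodgeGroupsK3, Thm. 1.5.1 and Thm. 1.6] -/
theorem lowPicardRealMultiplication_of_forall_oneCellCycle_of_cellHC32
    (hV : VerbitskyGuan_cohomology_K3HilbertSquareType) (hO : OGrady2008_dualBBFClass_algebraic) (hQ : QInvAlgebraic)
    (h12 : OneCycleOnCell[1, 2]) (h23 : OneCycleOnCell[2, 3]) (h27 : OneCycleOnCell[2, 7])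
    (h34 : OneCycleOnCell[3, 4]) (h35 : OneCycleOnCell[3, 5]) (h32 : CellHC[3, 2]) :
    Summit.HodgeConjecture.HodgeConjecture.Theses.MarkmanPartnerTransport.LowPicardRealMultiplication :=
  lowPicardRealMultiplication_of_six_cells (cellHC_of_forall_oneCellCycle_12 hV hO hQ h12)
    (cellHC_of_forall_oneCellCycle_23 hV hO hQ h23) (cellHC_of_forall_oneCellCycle_27 hV hO hQ h27) h32
    (cellHC_of_forall_oneCellCycle_34 hV hO hQ h34) (cellHC_of_forall_oneCellCycle_35 hV hO hQ h35)

/-- **Crux #5 BY NAME from Kuga–Satake on the quadratic cells `(1,2)`, `(3,2)` and one degree-`d` RM cycle per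
member on the four cells of degree `≥ 3`** (`cellHC_two_of_kugaSatake` for `ρ ∈ {1, 3}` + the cell closers above +
«CELL-SPLIT»). Modulo {Verbitsky–Guan, O'Grady, Charles–Markman 2013, Varesco 2023, Beauville 1983}; CONDITIONAL on
`KSHC` for the quadratic cells and on the one-cycle clauses; credits nothing to HC. [cite: Varesco2023, Cor. 4.6 and Conj. 4.2]
[cite: CharlesMarkman2013, Thm. 1.1 (§1)] [cite: Markman2024, §1.1 Thm. 1.1] [cite: Vangeemen2008, Lemma 3.2] -/
theorem lowPicardRealMultiplication_of_kugaSatake_of_forall_oneCellCycle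
    (hV : VerbitskyGuan_cohomology_K3HilbertSquareType) (hO : OGrady2008_dualBBFClass_algebraic)
    (hB : CharlesMarkman2013_lefschetzStandard_K3HilbertType)
    (hVar : Varesco2023_transcendentalHodgeSimilitude_algebraic_of_lefschetzStandard)
    (hBea : Beauville1983_irreducibleSymplectic_of_k3HilbertType)
    (hKS : ∀ (X : SchemeOver ℂ) (hX : IsSmoothProjective 4 X), IsOfK3HilbertSquareType X →
      ∀ (φ : complexBetti X 2 ≃ₗ[ℂ] (K3HilbertIndex → ℂ)) (P : complexBetti X (2 * 4)) (z : K3HilbertIndex → ℂ),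
        MarkedK3Sq[X, φ, P, z] → ¬ SpIso[X, φ] → RMgen[X, φ, z, 2] → KSHC[hX])
    (h23 : OneCycleOnCell[2, 3]) (h27 : OneCycleOnCell[2, 7]) (h34 : OneCycleOnCell[3, 4]) (h35 : OneCycleOnCell[3, 5]) :
    Summit.HodgeConjecture.HodgeConjecture.Theses.MarkmanPartnerTransport.LowPicardRealMultiplication :=
  have hQ : QInvAlgebraic := qInvAlgebraic_of_charlesMarkman hV hB
  lowPicardRealMultiplication_of_kugaSatake_of_four_cells hV hO hB hVar hBea hKS
    (cellHC_of_forall_oneCellCycle_23 hV hO hQ h23) (cellHC_of_forall_oneCellCycle_27 hV hO hQ h27)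
    (cellHC_of_forall_oneCellCycle_34 hV hO hQ h34) (cellHC_of_forall_oneCellCycle_35 hV hO hQ h35)

end Summit.HodgeConjecture.HodgeConjecture.Theorems.MarkmanPartnerTransport.PartnerLattice

end
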